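import Literature.MathematicalPhysics.QuantumFieldTheory.LatticeGaugeProofs
import HarnessLib

/-!
# The overlapping block heat-bath sampler of the torus Wilson theory — vocabulary

Block dynamics ("block heat bath", "block Glauber / Gibbs sampler") of a finite-volume Gibbs measure resample all the
variables of a block from their conditional law given the exterior (Martinelli 1999 §3–4: block dynamics, their
Dirichlet forms `∑_B E[Var(f | 𝓕_{Bᶜ})]` and Poincaré / spectral-gap inequalities; Martinelli–Olivieri 1994).  For the
Wilson lattice gauge theory `wilsonMeasure ρ β` on the discrete torus `(ℤ/N)⁴` (tree `ConstructiveQFTWave0`) this file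
fixes the GEOMETRY and the two INEQUALITIES of the overlapping block sampler used by block-spectral-gap arguments,
as definitions only (nothing is asserted):

* `cellOf N m` — the `m` uneven cells `[⌈jN/m⌉, ⌈(j+1)N/m⌉)` of `ℤ/N` (lengths in `{⌊N/m⌋, ⌈N/m⌉}`; every side `N`,
  odd or not, is covered), `InBlock N m z x` — the OVERLAPPING block `B_z` = the `2⁴`-cluster of cells `{z_k, z_k+1}`
  in every axis (neighbouring blocks overlap in a full cell), `InPatch n₀ ζ z` — sup-cyclic index distance `< n₀`
  (the cyclic index distance, `ZMod.valMinAbs`);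
* `linkSigma S` — the σ-algebra generated by the link variables in an edge set `S`; `extSigma`, `patchExtSigma` — the
  exterior σ-algebras of a block / of a patch of blocks (conditioning on them is the heat-bath projection);
* `LocalPoincare ρ β N b n₀ γ` — the local Poincaré inequality of the sampler on `n₀`-patches with constant `γ`, on
  bounded measurable GAUGE-INVARIANT functions (integrated = worst-exterior form);
  `GlobalPoincare ρ β N b γ` — the global one (spectral gap `≥ γ` of `∑_z (1 − E[·|extSigma z])` on `L²(μ)^𝒢`).

References: F. Martinelli, *Lectures on Glauber dynamics for discrete spin models*, LNM 1717 (1999), §3 (block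
dynamics) and §4; F. Martinelli, E. Olivieri, CMP 161 (1994) 447 and 487; K. Wilson, Phys. Rev. D 10 (1974) 2445 /
E. Seiler, LNP 159 (1982) Ch. 1 for the lattice gauge vocabulary.  Deliberately NOT here: any claim that these
inequalities hold (that is the content of the mass-gap problem at one physical scale), the semigroup, clustering.
-/

open scoped BigOperators
open MeasureTheory
open Literature.MathematicalPhysics.QuantumFieldTheory

noncomputable section

namespace Literature.MathematicalPhysics.QuantumLattice.WilsonBlockHeatBath

section Blocks

variable {G : Type} [MeasurableSpace G] {N : ℕ}

/-- The cell of a torus coordinate: `⌊x·m/N⌋ ∈ ℤ/m` — the `m` uneven cells `[⌈jN/m⌉, ⌈(j+1)N/m⌉)` of `ℤ/N` have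
lengths in `{⌊N/m⌋, ⌈N/m⌉} ⊂ [b, 2b]` when `m = N/b`, `N ≥ 2b` (every torus side, odd sides `2S+1` included).
[folklore] -/
def cellOf (N m : ℕ) (x : ZMod N) : ZMod m :=
  ((x.val * m / N : ℕ) : ZMod m)

/-- Site `x` lies in the OVERLAPPING block `B_z`, the `2⁴`-cluster of cells `{z_k, z_k + 1}` in every axis (block
side ∈ `[2b, 4b]`, neighbouring blocks overlap in a full cell `≥ b`; Martinelli 1999 §3, block dynamics with
overlapping blocks). [folklore] -/
def InBlock (N m : ℕ) (z : Fin 4 → Fin m) (x : Site 4 N) : Prop :=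
  ∀ k, (cellOf N m (x k) - ((z k : ℕ) : ZMod m)).val ≤ 1

/-- Block `z` lies in the `n₀`-patch centred at `ζ`: sup-cyclic index distance `< n₀`, the cyclic distance of
`z k, ζ k : Fin m` being `|z k − ζ k|` around `ℤ/m` (`ZMod.valMinAbs`; definitionally the `cdist` of
`Literature/Analysis/OperatorTheory/KnabeGapAmplification.lean`, inlined to keep this file import-light). [folklore] -/
def InPatch {m : ℕ} (n₀ : ℕ) (ζ z : Fin 4 → Fin m) : Prop :=
  ∀ k, ((((z k : ℕ) : ZMod m) - ((ζ k : ℕ) : ZMod m)).valMinAbs).natAbs < n₀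

/-- `InPatch` is decidable (a finite conjunction of `<` on `ℕ`), so patch sums can be written with `if`. [folklore] -/
instance instDecidableInPatch {m : ℕ} (n₀ : ℕ) (ζ z : Fin 4 → Fin m) : Decidable (InPatch n₀ ζ z) := by
  unfold InPatch; infer_instance

/-- σ-algebra generated by the link variables in a set `S` of edges of the torus of side `N`
(the coordinate σ-algebra `𝓕_S`; Martinelli 1999 §2.1). [folklore] -/
@[reducible] def linkSigma (S : Set (Edge 4 N)) : MeasurableSpace (GaugeConfig 4 N G) :=
  MeasurableSpace.comap (fun (U : GaugeConfig 4 N G) (e : S) => U e.1) MeasurableSpace.pi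

variable (G) in
/-- The EXTERIOR σ-algebra of block `z`: links (based) outside `B_z`. `1 − E[· | extSigma z]` is the heat-bath
projection `Q_z` of the block (Martinelli 1999 §3, the block heat-bath kernel). [folklore] -/
@[reducible] def extSigma (N m : ℕ) (z : Fin 4 → Fin m) : MeasurableSpace (GaugeConfig 4 N G) :=
  linkSigma {e | ¬ InBlock N m z e.1}

variable (G) in
/-- The exterior σ-algebra of the `n₀`-patch centred at `ζ`: links outside every block of the patch. [folklore] -/
@[reducible] def patchExtSigma (N m n₀ : ℕ) (ζ : Fin 4 → Fin m) : MeasurableSpace (GaugeConfig 4 N G) :=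
  linkSigma {e | ∀ z : Fin 4 → Fin m, InPatch n₀ ζ z → ¬ InBlock N m z e.1}

end Blocks

section Sampler

variable {G : Type} [Group G] [TopologicalSpace G] [IsTopologicalGroup G] [CompactSpace G]
  [MeasurableSpace G] [BorelSpace G] {Nρ : ℕ}

/-- **Local Poincaré inequality of the overlapping block sampler** of the torus Wilson theory `wilsonMeasure ρ β` on
`(ℤ/N)⁴`, nominal cell `b` (`m = N/b` cells per axis), patch size `n₀`, constant `γ`: for every patch centre `ζ` and
every bounded measurable GAUGE-INVARIANT `F`,
`∫ (F − μ[F | patch exterior])² dμ ≤ γ⁻¹ ∑_{z ∈ patch} ∫ (F − μ[F | exterior of B_z])² dμ`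
— in operator language `γ A_P ≤ A_P²` on `L²(μ)^𝒢` for the patch operator `A_P = ∑_{z ∈ P} Q_z` (Martinelli 1999
§3–4: Poincaré inequality / spectral gap of a block dynamics in a finite region, here in the integrated =
worst-exterior form). [folklore] -/
def LocalPoincare (ρ : G →* Matrix (Fin Nρ) (Fin Nρ) ℂ) (β : ℝ) (N b n₀ : ℕ) [NeZero N] (γ : ℝ) : Prop :=
  ∀ (ζ : Fin 4 → Fin (N / b)) (F : GaugeConfig 4 N G → ℝ), Measurable F → (∃ B : ℝ, ∀ U, |F U| ≤ B) →
    IsGaugeInvariant F →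
      ∫ U, (F U - ((wilsonMeasure (d := 4) (L := N) ρ β)[F|patchExtSigma G N (N / b) n₀ ζ]) U) ^ 2
          ∂(wilsonMeasure (d := 4) (L := N) ρ β) ≤
        γ⁻¹ * ∑ z : Fin 4 → Fin (N / b), if InPatch n₀ ζ z then
          ∫ U, (F U - ((wilsonMeasure (d := 4) (L := N) ρ β)[F|extSigma G N (N / b) z]) U) ^ 2
            ∂(wilsonMeasure (d := 4) (L := N) ρ β) else 0

/-- **Global Poincaré inequality of the overlapping block sampler** (spectral gap `≥ γ` of `H = ∑_z Q_z` on
`L²(μ)^𝒢`): `Var_μ(F) ≤ γ⁻¹ ∑_z ∫ (F − μ[F | exterior of B_z])² dμ` for every bounded measurable gauge-invariant `F`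
on the torus `(ℤ/N)⁴`, cells `m = N/b` (Martinelli 1999 §3, eq. for the spectral gap of block dynamics). [folklore] -/
def GlobalPoincare (ρ : G →* Matrix (Fin Nρ) (Fin Nρ) ℂ) (β : ℝ) (N b : ℕ) [NeZero N] (γ : ℝ) : Prop :=
  ∀ (F : GaugeConfig 4 N G → ℝ), Measurable F → (∃ B : ℝ, ∀ U, |F U| ≤ B) → IsGaugeInvariant F →
    ∫ U, (F U - ∫ V, F V ∂(wilsonMeasure (d := 4) (L := N) ρ β)) ^ 2
        ∂(wilsonMeasure (d := 4) (L := N) ρ β) ≤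
      γ⁻¹ * ∑ z : Fin 4 → Fin (N / b),
        ∫ U, (F U - ((wilsonMeasure (d := 4) (L := N) ρ β)[F|extSigma G N (N / b) z]) U) ^ 2
          ∂(wilsonMeasure (d := 4) (L := N) ρ β)

end Sampler

end Literature.MathematicalPhysics.QuantumLattice.WilsonBlockHeatBath

end
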